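import Summits.ABC.IUTFork.Joshi.ATS4Lem671BadPrimesRamifiedGenuine
import Summits.ABC.IUTFork.Joshi.ATS4ExistenceLemmasCurves
import Summits.ABC.IUTFork.Joshi.ATS4InitialThetaDataExistence
import Summits.ABC.IUTFork.LDHSUnitFamilyPoint
import Literature.NumberTheory.DiophantineGeometry.GenEllTorsionFieldBaseChangeEmbedded
import Literature.IUT.LogVolume.Corollary22ThetaFieldExists
import Literature.IUT.HodgeTheaters.InitialThetaDataArith
import HarnessLib

/-!
# [J-IV] (arXiv:2403.10430v2) Lemma 6.7.1 AT JOSHI'S ACTUAL `L′ = L(C[ℓ])`: the binder «`Γ_K` fixes `E_K[ℓ]`» of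
# `ATS4Lem671BadPrimesRamifiedGenuine` SUPPLIED in kernel, the hypothesis set INHABITED, the rider's provenance carried BY NAME

Proof-only companion (0 defs) of the abc-iut cell, R-J rows **Y-21c** (`LocusVolumeDatum.Eq6111`) / **Y-21e**
(`LocusVolumeDatum.ComponentSums`), rung LADDER-ABC:A2.RESCUE.J, seat abc-iut-E-t35 (gen 8; authors-first sequel of its own
p462498/p462897 `Joshi/ATS4Lem671BadPrimesRamifiedGenuine.lean`). SOURCE: K. Joshi, *Construction of Arithmetic Teichmüller
Spaces IV*, arXiv:2403.10430v2 (unrefereed; bib `Joshi2024ATS4`), Lemma 6.7.1 p.61 l.20–30, §6.6 p.60 l.56–62, Lemma 5.8.7 (2)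
p.56 l.33–38, Thm. 5.7.1 p.53 l.31–46, Thm. 6.1.1 p.58 l.1–3 («equipped with the prime number `ℓ` and Initial Theta Data …
provided by Theorem 5.7.1»); [J-III] (arXiv:2401.13508v4) §3.3 (13) p.28 l.11 («Let `L′` be the fixed field of the kernel of the
homomorphism `ρ_{C/L;ℓ}`»). Page/line = the cell's render `HOME/lit/renders/Joshi-arxiv-2403.10430/`. FRAMING (binding):
classical arithmetic composed with the tree's PROVED theorems; NO side is taken on [IUTchIII] Cor. 3.12 / [IUTchIV] Thm. 1.10, on
Joshi's claims or on Mochizuki's report on them; NOT a test verdict; NO abc claim. Typed ≠ proved ≠ endorsed.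

WHAT THE PARENT LEFT OPEN. Every rider-carrying theorem of p462498/p462897 binds
`hKℓ : ∀ σ : Γ_K, ∀ Q ∈ E_K[ℓ](K̄), σ • Q = Q` — «`K ⊇ F(E_F[ℓ])`», print's (13) `L′ = L(C[ℓ])` — and no kernel term inhabited
it at a genuine `K` (the parent's declared scope; the counted reader's INFO I2, abc-iut-E-t25 2026-08-26T19:26:50Z). The cell's
carriers present `L′` as an ABSTRACT number field `K` with an `F`-embedding `ψ : K →ₐ[F] F̄` («`K ⊆ F(E_F[ℓ])`» =
`ker ρ̄_{E_F,ℓ} ≤ ψ.fieldRange.fixingSubgroup`, E-t31 `ThetaTower.hKunr`, E-t24 p460339, E-t33), so the transport needed is the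
abstract-field one, `WeierstrassCurve.forall_smul_geomTorsion_map_eq_of_fieldRange_fixingSubgroup_le`
(`Literature/NumberTheory/DiophantineGeometry/GenEllTorsionFieldBaseChangeEmbedded.lean`, this seat, p466034; [GenEll] Thm. 3.8
transport for an abstract `K`).

WHAT IS PROVED (all modulo NOTHING but the stated binders; `λ ∈ U_X`, `F` a theta field of `λ`, `ℓ` prime):
* §1 `GenuineVdst.forall_smul_geomTorsion_eq_of_fieldRange_fixingSubgroup_le` — **`hKℓ` HOLDS at every `K ⊇ F(E_F[ℓ])`** in
  `Γ_F`-currency (`ψ.fieldRange.fixingSubgroup ≤ ker ρ̄_{E_F,ℓ}`); `…_of_fieldRange_eq_divisionField` — at every abstract copy of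
  `L′` (`ψ.fieldRange = F(E_F[ℓ])`, which gives BOTH containments: `ker_le_…` is the cell's `hK`); `…_divisionField_eq` — at the
  tree's division field `F(E_F[ℓ]) ⊆ F̄` itself.
* §2 the parent's `ell_dvd_relRamIdx…` (**`ℓ ∣ e_{u|w}`** at every `u ∤ ℓ` over a bad place), `two_le_absRamificationIdx…`,
  `h412_ofNFPointOver` (the `h412` of p456387 discharged) RESTATED with `hKℓ` replaced by «`K ⊇ L′`» in `ψ`-currency — modulo the
  rider (P2) `Cor22.CondP2 P ℓ` only; and rows **Y-21e / Y-21c under the §6.6 DEFINITION** (`componentSums_divisionTower_defn_of_le_ker`,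
  `eq6111_divisionTower_defn_of_le_ker`) likewise.
* §3 **Lemma 6.7.1 (1) ⟺ (3) AWAY FROM `30ℓ` AT JOSHI'S ACTUAL `L′`**: the parent's v2 §5 with its two opposite containments
  `hK ∧ hKℓ` replaced by the single equation `ψ.fieldRange = (thetaCurve P F).divisionField ℓ` (`K/F` Galois is then automatic),
  modulo (P2) only (`primeFactors_discr_sdiff_eq_reading3_sdiff_of_fieldRange_eq_divisionField`).
* §4 **NON-VACUITY IN KERNEL**: for EVERY `λ ∈ U_X` and EVERY prime `ℓ ≥ 7` with (P2) there are a theta field `F` and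
  `K = L′ = F(E_F[ℓ])` Galois over `F` at which `hKℓ` holds, `ℓ ∣ e_{u|w}` over the bad places, and (1) ⟺ (3) off `30ℓ` for Joshi's
  `S = {2, ℓ}` (`exists_thetaField_divisionField_lem671`); and ONE EXPLICIT INSTANCE of the whole hypothesis set
  (`lem671_hypotheses_inhabited`: the S-unit point `P_{1,1} = (F_{1,1}, λ_{1,1})` of `LDHSUnitFamilyPoint` — `λ_{1,1}` a root of
  `z² − (2 + 5/7)z + 5/7` — with `ℓ = 7`, where `λ ∈ U` is `SUnitFamily.P_mem_UP` and (P2) is `SUnitFamily.condP2_P`).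
* §5 **PROVENANCE OF THE RIDER, BY NAME**: the same statements at Joshi's OWN prime — `IsLem587Prime d λ ℓ` (E-t29/E-t30's typing
  of the prime of Lemma 5.8.7 = the `ℓ` of Thm. 5.7.1 = the `ℓ` «equipped» in Thm. 6.1.1 under whose assumptions Lemma 6.7.1 is
  stated, E-lit 2026-08-26T19:13:46Z) and `ITDConditions λ ℓ` (E-t33's reading of «satisfies Initial Theta Data with the prime
  `ℓ`») — carry (P2) as a conjunct, so «modulo (P2)» costs nothing for the print's `ℓ` (E-plan 19:10:49Z «rider located in OUR
  carrier (ℓ's provenance not carried), automatic in print» — now carried; E-t25 INFO I1 concordant).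

NOT treated (honest scope, unchanged): the clause «the primes of `30ℓ` ramify in `L′`» of (3)/(4) ⟹ (2) (print: `L′ ⊇ μ_{4·3·5·ℓ}`
by the Weil pairing, which the tree does not have for `galoisRepTorsion`; located by E-t24 p465152 `…_iff_thirtyL_of_condP2`).
Theorems only; standard axioms; no `sorry`, instance, notation, `def` or new `Prop`; DEFS-FREEZE respected (imports only).
[claim: Joshi2024ATS4, status: disputed].
-/

noncomputable section

open Finset NumberField IsDedekindDomain
open Literature.IUT.LogVolume Literature.IUT.LogVolume.Cor22
open Literature.NumberTheory.DiophantineGeometry.GenEll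
open Literature.IUT.HodgeTheaters (TorsionField)

namespace Summit.ABC.IUTFork.Joshi.ATS4

namespace GenuineVdst

variable {P : NFPoint} {F : Type} [Field F] [NumberField F] [Algebra P.F F]
variable {K : Type} [Field K] [NumberField K] [Algebra F K] [Algebra P.F K] [IsScalarTower P.F F K]
variable (ψ : K →ₐ[F] AlgebraicClosure F)

/-! ## 1. The binder `hKℓ` («`Γ_K` fixes `E_K[ℓ](K̄)`», `K ⊇ F(E_F[ℓ])`) SUPPLIED -/

/-- **`hKℓ` HOLDS at every `K ⊇ F(E_F[ℓ])`** (in `Γ_F`-currency: every element of `Γ_F` fixing `ψ(K)` acts trivially on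
`E_F[ℓ](F̄)`): `Gal(K̄/K)` fixes every `ℓ`-torsion point of the Legendre curve `E_K` over `K̄ = AlgebraicClosure K`. The
abstract-field [GenEll] transport (p466034) composed with `E_F ⊗_F K = E_K` (`thetaCurve_baseChange`). This is print's (13)
«`L′ ⊇ L(C[ℓ])`-half» in the form the parent file binds. PROVED. [claim: Joshi2024ATS3, status: disputed]
[cite: MochizukiGenEll2010, Thm 3.8 p.20] -/
theorem forall_smul_geomTorsion_eq_of_fieldRange_fixingSubgroup_le {ℓ : ℕ}
    (hK' : ψ.fieldRange.fixingSubgroup ≤ ((thetaCurve P F).galoisRepTorsion (ℓ : ℤ)).ker) :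
    ∀ (σ : Field.absoluteGaloisGroup K) (Q : WeierstrassCurve.geomTorsion (thetaCurve P K) (ℓ : ℤ)), σ • Q = Q := by
  rw [← thetaCurve_baseChange (F := F) (K := K)]
  exact (thetaCurve P F).forall_smul_geomTorsion_map_eq_of_fieldRange_fixingSubgroup_le ℓ ψ hK'

omit [NumberField K] [Algebra P.F K] [IsScalarTower P.F F K] in
/-- At an abstract copy of **`L′ = F(E_F[ℓ])` EXACTLY** (`ψ.fieldRange = (thetaCurve P F).divisionField ℓ`): the cell's `hK`
(«`K ⊆ L′`», `ker ρ̄ ≤ ψ.fieldRange.fixingSubgroup`) AND the parent's «`K ⊇ L′`» (`ψ.fieldRange.fixingSubgroup ≤ ker ρ̄`) both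
hold (`WeierstrassCurve.fixingSubgroup_divisionField_eq_ker`). [claim: Joshi2024ATS3, status: disputed] -/
theorem ker_le_and_le_ker_of_fieldRange_eq_divisionField (hU : P.InU) {ℓ : ℕ} [NeZero ℓ]
    (hψ : ψ.fieldRange = (thetaCurve P F).divisionField ℓ) :
    ((thetaCurve P F).galoisRepTorsion (ℓ : ℤ)).ker ≤ ψ.fieldRange.fixingSubgroup ∧
      ψ.fieldRange.fixingSubgroup ≤ ((thetaCurve P F).galoisRepTorsion (ℓ : ℤ)).ker := by
  haveI := thetaCurve_isElliptic hU F
  exact (thetaCurve P F).ker_le_and_le_ker_of_fieldRange_eq_divisionField ℓ ψ hψ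

/-- **`hKℓ` at every abstract copy of `L′ = F(E_F[ℓ])`** (`ψ.fieldRange = (thetaCurve P F).divisionField ℓ`). PROVED.
[claim: Joshi2024ATS3, status: disputed] -/
theorem forall_smul_geomTorsion_eq_of_fieldRange_eq_divisionField (hU : P.InU) {ℓ : ℕ} [NeZero ℓ]
    (hψ : ψ.fieldRange = (thetaCurve P F).divisionField ℓ) :
    ∀ (σ : Field.absoluteGaloisGroup K) (Q : WeierstrassCurve.geomTorsion (thetaCurve P K) (ℓ : ℤ)), σ • Q = Q :=
  forall_smul_geomTorsion_eq_of_fieldRange_fixingSubgroup_le ψ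
    (ker_le_and_le_ker_of_fieldRange_eq_divisionField ψ hU hψ).2

/-- **`hKℓ` at the tree's division field `L′ = F(E_F[ℓ]) ⊆ F̄` ITSELF** (`WeierstrassCurve.divisionField`, the `K` of
`InitialThetaDataJoshiSupply`, as the type `TorsionField (thetaCurve P F) ℓ` of `InitialThetaDataArith`; `E_F` elliptic, i.e.
`λ ∈ U_X` via `thetaCurve_isElliptic`): `Gal(L̄′/L′)` fixes `E_{L′}[ℓ](L̄′)`. PROVED. [claim: Joshi2024ATS3, status: disputed] -/
theorem forall_smul_geomTorsion_divisionField_eq [(thetaCurve P F).IsElliptic] (ℓ : ℕ) [NeZero ℓ] :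
    ∀ (σ : Field.absoluteGaloisGroup (TorsionField (thetaCurve P F) ℓ))
      (Q : WeierstrassCurve.geomTorsion (thetaCurve P (TorsionField (thetaCurve P F) ℓ)) (ℓ : ℤ)), σ • Q = Q := by
  rw [← thetaCurve_baseChange (F := F) (K := TorsionField (thetaCurve P F) ℓ)]
  exact (thetaCurve P F).forall_smul_geomTorsion_map_divisionField_eq ℓ

omit [NumberField K] [Algebra P.F K] [IsScalarTower P.F F K] in
/-- An abstract copy `K` of `L′ = F(E_F[ℓ])` is Galois over `F` (transport of `isGalois_divisionField` along `K ≃ ψ(K)`).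
[cite: SilvermanAEC2009, VIII.§1] -/
theorem isGalois_of_fieldRange_eq_divisionField (hU : P.InU) {ℓ : ℕ} [NeZero ℓ]
    (hψ : ψ.fieldRange = (thetaCurve P F).divisionField ℓ) : IsGalois F K := by
  haveI := thetaCurve_isElliptic hU F
  have e : K ≃ₐ[F] (thetaCurve P F).divisionField ℓ :=
    (AlgEquiv.ofInjectiveField ψ).trans (IntermediateField.equivOfEq hψ)
  exact IsGalois.of_algEquiv e.symm

/-! ## 2. The parent's theorems with `hKℓ` SUPPLIED: at every `K ⊇ L′` (`ψ`-currency), modulo (P2) only -/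

/-- **`ℓ ∣ e_{u|w}`** at every place `u ∤ ℓ` of `K ⊇ F(E_F[ℓ])` (`ψ.fieldRange.fixingSubgroup ≤ ker ρ̄_{E_F,ℓ}`) over a bad place
of `λ` — Lemma 6.7.1 (4) ⟹ (2) for the primes under `Supp(q_L)`, `ℓ ≥ 7`, modulo (P2); the parent's
`ell_dvd_relRamIdx_of_finBelow_mem_badPlaces` with `hKℓ` supplied by §1. PROVED. [claim: Joshi2024ATS4, status: disputed] -/
theorem ell_dvd_relRamIdx_of_le_ker (hU : P.InU) (hF : IsThetaField P F) {ℓ : ℕ} (hℓ : ℓ.Prime) (h7 : 7 ≤ ℓ)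
    (hP2 : CondP2 P ℓ) (hK' : ψ.fieldRange.fixingSubgroup ≤ ((thetaCurve P F).galoisRepTorsion (ℓ : ℤ)).ker)
    (u : HeightOneSpectrum (𝓞 K)) (hu : finBelow P.F K u ∈ badPlaces P) (hℓu : ((ℓ : ℕ) : 𝓞 K) ∉ u.asIdeal) :
    ℓ ∣ relRamIdx F K u :=
  ell_dvd_relRamIdx_of_finBelow_mem_badPlaces hU hF hℓ h7 hP2
    (forall_smul_geomTorsion_eq_of_fieldRange_fixingSubgroup_le ψ hK') u hu hℓu

/-- **`2 ≤ e(u|p_u)`** (ramified over `ℚ`) at every such `u`, modulo (P2), `hKℓ` supplied. PROVED.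
[claim: Joshi2024ATS4, status: disputed] -/
theorem two_le_absRamificationIdx_of_le_ker (hU : P.InU) (hF : IsThetaField P F) {ℓ : ℕ} (hℓ : ℓ.Prime) (h7 : 7 ≤ ℓ)
    (hP2 : CondP2 P ℓ) (hK' : ψ.fieldRange.fixingSubgroup ≤ ((thetaCurve P F).galoisRepTorsion (ℓ : ℤ)).ker)
    (u : HeightOneSpectrum (𝓞 K)) (hu : finBelow P.F K u ∈ badPlaces P) (hℓu : ((ℓ : ℕ) : 𝓞 K) ∉ u.asIdeal) :
    2 ≤ u.asIdeal.ramificationIdx ℤ :=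
  two_le_absRamificationIdx_of_finBelow_mem_badPlaces hU hF hℓ h7 hP2
    (forall_smul_geomTorsion_eq_of_fieldRange_fixingSubgroup_le ψ hK') u hu hℓu

/-- **`h412` of p456387 DISCHARGED at every `K ⊇ L′`** for Joshi's data `𝔮_F = ofNFPointOver λ S F`, `ℓ ∈ S`, modulo (P2),
`hKℓ` supplied: every `w ∈ Supp(𝔮_F)` has a place `u` of `K` above it, of the same residue characteristic, ramified over `ℚ`.
PROVED. [claim: Joshi2024ATS4, status: disputed] -/
theorem h412_ofNFPointOver_of_le_ker (hU : P.InU) (hF : IsThetaField P F) {ℓ : ℕ} (hℓ : ℓ.Prime) (h7 : 7 ≤ ℓ)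
    (hP2 : CondP2 P ℓ) (hK' : ψ.fieldRange.fixingSubgroup ≤ ((thetaCurve P F).galoisRepTorsion (ℓ : ℤ)).ker)
    {S : Finset ℕ} (hS : ℓ ∈ S) :
    ∀ w ∈ (TateDivisorDatum.ofNFPointOver P S F).V,
      ∃ u : HeightOneSpectrum (𝓞 K), residueChar K u = residueChar F w ∧ 2 ≤ u.asIdeal.ramificationIdx ℤ :=
  h412_ofNFPointOver hU hF hℓ h7 hP2 (forall_smul_geomTorsion_eq_of_fieldRange_fixingSubgroup_le ψ hK') hS

end GenuineVdst

section Rows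

variable {P : NFPoint} {F : Type} [Field F] [NumberField F] [Algebra P.F F]
variable {K : Type} [Field K] [NumberField K] [Algebra F K] [Algebra P.F K] [IsScalarTower P.F F K]
variable (ψ : K →ₐ[F] AlgebraicClosure F)

/-- **Row Y-21e (`ComponentSums`) with `V^dst_ℚ := primeFactors(disc K)` (the §6.6 DEFINITION) DERIVED at every `K ⊇ L′`**
(`ψ`-currency), `ℓ ≥ 7`, modulo (P2) ONLY — the parent's `componentSums_divisionTower_defn` with `hKℓ` supplied by §1. PROVED.
[claim: Joshi2024ATS4, status: disputed] -/
theorem LocusVolumeDatum.componentSums_divisionTower_defn_of_le_ker (d : LocusVolumeDatum) {T : PrimeTowerDatum}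
    (GT : PrimeTowerDatum.TowerGlue T d) (hU : P.InU) (hF : IsThetaField P F) {ℓ : ℕ} (hℓ : ℓ.Prime) (h7 : 7 ≤ ℓ)
    (hP2 : CondP2 P ℓ) (hK' : ψ.fieldRange.fixingSubgroup ≤ ((thetaCurve P F).galoisRepTorsion (ℓ : ℤ)).ker)
    {S : Finset ℕ} (hS : ℓ ∈ S)
    (hVdst : d.Vdst = (discr K).natAbs.primeFactors)
    (DK : Finset (HeightOneSpectrum (𝓞 K))) (hDK : ∀ u, differentDivisor K (Sum.inr u) ≠ 0 → u ∈ DK)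
    (hDiff : d.logDiffLp = logDifferent K)
    (hDiffAt : ∀ p ∈ d.Vdst, d.logDiffLpAt p =
      (Module.finrank ℚ K : ℝ)⁻¹ * ∑ u ∈ DK with residueChar K u = p, differentDivisor K (Sum.inr u) * logNorm K u)
    (hq : d.logq = (TateDivisorDatum.ofNFPointOver P S F).logq)
    (hqAt : ∀ p ∈ d.Vdst, d.logqAt p =
      (Module.finrank ℚ F : ℝ)⁻¹ * ∑ w ∈ (TateDivisorDatum.ofNFPointOver P S F).V with residueChar F w = p,
        (TateDivisorDatum.ofNFPointOver P S F).tateDivisor (Sum.inr w) * logNorm F w) :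
    d.ComponentSums :=
  d.componentSums_divisionTower_defn GT hU hF hℓ h7 hP2
    (GenuineVdst.forall_smul_geomTorsion_eq_of_fieldRange_fixingSubgroup_le ψ hK') hS hVdst DK hDK hDiff hDiffAt hq hqAt

/-- **Row Y-21c (`Eq6111`) with `V^dst_ℚ := primeFactors(disc K)` DERIVED at every `K ⊇ L′`** (`ψ`-currency), `ℓ ≥ 7`, modulo
(P2) ONLY — the parent's `eq6111_divisionTower_defn` with `hKℓ` supplied by §1. PROVED. [claim: Joshi2024ATS4, status: disputed] -/
theorem LocusVolumeDatum.eq6111_divisionTower_defn_of_le_ker (d : LocusVolumeDatum) {lstar : ℕ} {W : Type} [Fintype W]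
    {D : SecondMainBoundDatum lstar W} (G : DescentGlue D d) (hU : P.InU) (hF : IsThetaField P F) {ℓ : ℕ} (hℓ : ℓ.Prime)
    (h7 : 7 ≤ ℓ) (hP2 : CondP2 P ℓ) (hK' : ψ.fieldRange.fixingSubgroup ≤ ((thetaCurve P F).galoisRepTorsion (ℓ : ℤ)).ker)
    {S : Finset ℕ} (hS : ℓ ∈ S) (hVdst : d.Vdst = (discr K).natAbs.primeFactors)
    (ι : W → HeightOneSpectrum (𝓞 F)) (hι : ∀ w, ι w ∈ (TateDivisorDatum.ofNFPointOver P S F).V)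
    (hAt : ∀ p ∈ d.Vdst, d.logVolAt p =
      ∑ w ∈ Finset.univ with residueChar F (ι w) = p, |Real.log (D.std.loc w).hullVol|)
    (hArch : d.logVolArch = 0) : d.Eq6111 :=
  d.eq6111_divisionTower_defn G hU hF hℓ h7 hP2
    (GenuineVdst.forall_smul_geomTorsion_eq_of_fieldRange_fixingSubgroup_le ψ hK') hS hVdst ι hι hAt hArch

end Rows

/-! ## 3. Lemma 6.7.1 (1) ⟺ (3) away from `30ℓ` AT JOSHI'S ACTUAL `L′ = F(E_F[ℓ])`, modulo (P2) only -/

namespace GenuineVdst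

variable {P : NFPoint} {F : Type} [Field F] [NumberField F] [Algebra P.F F]
variable {K : Type} [Field K] [NumberField K] [Algebra F K] [Algebra P.F K] [IsScalarTower P.F F K]
variable (ψ : K →ₐ[F] AlgebraicClosure F)

/-- **Lemma 6.7.1 (1) ⟺ (3) AWAY FROM the primes of `30ℓ` at `K = L′ = F(E_F[ℓ])`** (any abstract copy:
`ψ.fieldRange = (thetaCurve P F).divisionField ℓ`; `λ ∈ U_X`, `F` a theta field, `ℓ ≥ 7` prime), MODULO (P2) ONLY, for Joshi's
data `𝔮_{F_tpd} = ofNFPoint λ S` (`S ⊆ {2,3,5,ℓ}` primes, `ℓ ∈ S`; his `S = {2, ℓ}`): the §6.6 DEFINITION of `V^dst_ℚ`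
(`primeFactors(disc L′)`) and READING (3) (`p(Supp 𝔮_{F_tpd}) ∪ primeFactors(disc F_tpd)`) have the same primes off `30ℓ`. The
parent's v2 §5 `primeFactors_discr_sdiff_eq_reading3_sdiff`, whose opposite containments `hK` («`K ⊆ L′`») and `hKℓ` («`K ⊇ L′`»)
and whose `K/F` Galois are ALL supplied from the one equation by §1. PROVED. [claim: Joshi2024ATS4, status: disputed] -/
theorem primeFactors_discr_sdiff_eq_reading3_sdiff_of_fieldRange_eq_divisionField (hU : P.InU) (hF : IsThetaField P F)
    {ℓ : ℕ} (hℓ : ℓ.Prime) (h7 : 7 ≤ ℓ) (hP2 : CondP2 P ℓ) (hψ : ψ.fieldRange = (thetaCurve P F).divisionField ℓ)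
    {S : Finset ℕ} (hS : S ⊆ ({2, 3, 5, ℓ} : Finset ℕ)) (hSp : ∀ p ∈ S, p.Prime) (hℓS : ℓ ∈ S) :
    (discr K).natAbs.primeFactors \ (2 * 3 * 5 * ℓ).primeFactors =
      ((TateDivisorDatum.ofNFPoint P S).V.image (residueChar P.F) ∪ (discr P.F).natAbs.primeFactors) \
        (2 * 3 * 5 * ℓ).primeFactors := by
  haveI : NeZero ℓ := ⟨hℓ.ne_zero⟩
  haveI : IsGalois F K := isGalois_of_fieldRange_eq_divisionField ψ hU hψ
  obtain ⟨hK, hK'⟩ := ker_le_and_le_ker_of_fieldRange_eq_divisionField ψ hU hψ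
  exact primeFactors_discr_sdiff_eq_reading3_sdiff ψ hU hF hℓ h7 hP2 hK
    (forall_smul_geomTorsion_eq_of_fieldRange_fixingSubgroup_le ψ hK') hS hSp hℓS

/-! ## 4. NON-VACUITY: the hypothesis set of the parent file is INHABITED in kernel -/

/-- `{2, ℓ} ⊆ {2, 3, 5, ℓ}`. [folklore] -/
theorem pair_subset_quad (ℓ : ℕ) : ({2, ℓ} : Finset ℕ) ⊆ ({2, 3, 5, ℓ} : Finset ℕ) := by
  intro p hp
  simp only [Finset.mem_insert, Finset.mem_singleton] at hp ⊢
  rcases hp with rfl | rfl <;> simp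

/-- The primes of `{2, ℓ}` are prime (`ℓ` prime). [folklore] -/
theorem prime_of_mem_pair {ℓ : ℕ} (hℓ : ℓ.Prime) : ∀ p ∈ ({2, ℓ} : Finset ℕ), p.Prime := by
  intro p hp
  simp only [Finset.mem_insert, Finset.mem_singleton] at hp
  rcases hp with rfl | rfl
  · exact Nat.prime_two
  · exact hℓ

omit [NumberField F] [Algebra P.F F] in
/-- **For EVERY `λ ∈ U_X` and EVERY prime `ℓ ≥ 7` with (P2): a theta field `F` and `K = L′ = F(E_F[ℓ])` (Galois over `F`,
`ψ(K) = F(E_F[ℓ])`) EXIST at which `hKℓ` holds, `ℓ ∣ e_{u|w}` at every `u ∤ ℓ` over a bad place of `λ`, and Lemma 6.7.1 (1) ⟺ (3)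
off `30ℓ` holds for Joshi's `S = {2, ℓ}`** — the parent file's hypothesis set minus (P2) is inhabited over every admissible
`(λ, ℓ)` (theta field: the tree's `Cor22.exists_isThetaField`, [IUTchIV] Prop. 1.8 (v)/(vi); `L′`: `WeierstrassCurve.divisionField`).
PROVED. [claim: Joshi2024ATS4, status: disputed] -/
theorem exists_thetaField_divisionField_lem671 (P : NFPoint) (hU : P.InU) {ℓ : ℕ} (hℓ : ℓ.Prime) (h7 : 7 ≤ ℓ)
    (hP2 : CondP2 P ℓ) :
    ∃ (F : Type) (_ : Field F) (_ : NumberField F) (_ : Algebra P.F F) (K : Type) (_ : Field K) (_ : NumberField K)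
      (_ : Algebra F K) (_ : Algebra P.F K) (_ : IsScalarTower P.F F K) (_ : IsGalois F K) (ψ : K →ₐ[F] AlgebraicClosure F),
      IsThetaField P F ∧ ψ.fieldRange = (thetaCurve P F).divisionField ℓ ∧
      (∀ (σ : Field.absoluteGaloisGroup K) (Q : WeierstrassCurve.geomTorsion (thetaCurve P K) (ℓ : ℤ)), σ • Q = Q) ∧
      (∀ u : HeightOneSpectrum (𝓞 K), finBelow P.F K u ∈ badPlaces P → ((ℓ : ℕ) : 𝓞 K) ∉ u.asIdeal →
        ℓ ∣ relRamIdx F K u) ∧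
      (discr K).natAbs.primeFactors \ (2 * 3 * 5 * ℓ).primeFactors =
        ((TateDivisorDatum.ofNFPoint P {2, ℓ}).V.image (residueChar P.F) ∪ (discr P.F).natAbs.primeFactors) \
          (2 * 3 * 5 * ℓ).primeFactors := by
  obtain ⟨F₀, hNF, hF⟩ := exists_isThetaField P hU
  haveI := hNF
  haveI := thetaCurve_isElliptic hU F₀
  haveI : NeZero ℓ := ⟨hℓ.ne_zero⟩
  haveI : NumberField ((thetaCurve P F₀).divisionField ℓ) := NumberField.of_module_finite F₀ _
  have hval : ((thetaCurve P ↥F₀).divisionField ℓ).val.fieldRange = (thetaCurve P ↥F₀).divisionField ℓ :=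
    IntermediateField.fieldRange_val _
  refine ⟨F₀, inferInstance, inferInstance, inferInstance, ↥((thetaCurve P ↥F₀).divisionField ℓ), inferInstance,
    inferInstance, inferInstance, inferInstance, inferInstance, inferInstance, ((thetaCurve P ↥F₀).divisionField ℓ).val, hF,
    hval, forall_smul_geomTorsion_divisionField_eq ℓ, fun u hu hℓu => ?_, ?_⟩
  · exact ell_dvd_relRamIdx_of_le_ker _ hU hF hℓ h7 hP2 (ker_le_and_le_ker_of_fieldRange_eq_divisionField _ hU hval).2
      u hu hℓu
  · exact primeFactors_discr_sdiff_eq_reading3_sdiff_of_fieldRange_eq_divisionField _ hU hF hℓ h7 hP2 hval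
      (pair_subset_quad ℓ) (prime_of_mem_pair hℓ) (by simp)

/-- **ONE EXPLICIT INSTANCE of the whole hypothesis set** `{λ ∈ U_X, F theta field, K = L′, ℓ ≥ 7 prime, (P2)}` of
`ATS4Lem671BadPrimesRamifiedGenuine`: the S-unit point `P_{1,1} = (F_{1,1}, λ_{1,1})` (`SUnitFamily.Pt 1 1`; `λ_{1,1}` a root of
`z² − (2 + 5/7)z + 5/7` in the quadratic field `F_{1,1}`, `LDHSUnitFamilyPoint`) with `ℓ = 7`: `λ ∈ U` (`SUnitFamily.P_mem_UP`),
(P2) at `7` (`SUnitFamily.condP2_P`: the poles of `j(λ)` have orders `−2, −2, −2`), whence the package of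
`exists_thetaField_divisionField_lem671`. So NO theorem of the parent file is vacuously true. PROVED.
[claim: Joshi2024ATS4, status: disputed] [cite: Mochizuki2012, IUTchIV Cor 2.2 (ii) proof (P2) p.45] -/
theorem lem671_hypotheses_inhabited :
    ∃ (P : NFPoint) (ℓ : ℕ), P.InU ∧ ℓ.Prime ∧ 7 ≤ ℓ ∧ CondP2 P ℓ ∧
    ∃ (F : Type) (_ : Field F) (_ : NumberField F) (_ : Algebra P.F F) (K : Type) (_ : Field K) (_ : NumberField K)
      (_ : Algebra F K) (_ : Algebra P.F K) (_ : IsScalarTower P.F F K) (_ : IsGalois F K) (ψ : K →ₐ[F] AlgebraicClosure F),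
      IsThetaField P F ∧ ψ.fieldRange = (thetaCurve P F).divisionField ℓ ∧
      (∀ (σ : Field.absoluteGaloisGroup K) (Q : WeierstrassCurve.geomTorsion (thetaCurve P K) (ℓ : ℤ)), σ • Q = Q) ∧
      (∀ u : HeightOneSpectrum (𝓞 K), finBelow P.F K u ∈ badPlaces P → ((ℓ : ℕ) : 𝓞 K) ∉ u.asIdeal →
        ℓ ∣ relRamIdx F K u) ∧
      (discr K).natAbs.primeFactors \ (2 * 3 * 5 * ℓ).primeFactors =
        ((TateDivisorDatum.ofNFPoint P {2, ℓ}).V.image (residueChar P.F) ∪ (discr P.F).natAbs.primeFactors) \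
          (2 * 3 * 5 * ℓ).primeFactors := by
  have hU : (SUnitFamily.Pt 1 1).InU := (SUnitFamily.P_mem_UP (a := 1) (c := 1) le_rfl le_rfl).1
  have h7 : Nat.Prime 7 := by norm_num
  have hP2 : CondP2 (SUnitFamily.Pt 1 1) 7 :=
    SUnitFamily.condP2_P (a := 1) (c := 1) le_rfl le_rfl h7 (by norm_num) (by norm_num) (by norm_num)
  exact ⟨SUnitFamily.Pt 1 1, 7, hU, h7, le_rfl, hP2, exists_thetaField_divisionField_lem671 _ hU h7 le_rfl hP2⟩

/-! ## 5. PROVENANCE of the rider (P2), BY NAME: Joshi's own prime of Lemma 5.8.7 / «Initial Theta Data with the prime `ℓ`» -/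

/-- **At the prime of Lemma 5.8.7** (`IsLem587Prime d λ ℓ`, E-t29/E-t30 — the `ℓ` «provided by Theorem 5.7.1» with which
Thm. 6.1.1 equips `C_λ`, under whose assumptions Lemma 6.7.1 is stated; its clause (2) «`ℓ ∤ a_v`» IS (P2)): `ℓ ∣ e_{u|w}` at every
`u ∤ ℓ` of `K ⊇ L′` over a bad place, `ℓ ≥ 7` — no separate (P2) binder. PROVED. [claim: Joshi2024ATS4, status: disputed] -/
theorem ell_dvd_relRamIdx_of_isLem587Prime (hU : P.InU) (hF : IsThetaField P F) {d ℓ : ℕ} (hℓP : IsLem587Prime d P ℓ)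
    (h7 : 7 ≤ ℓ) (hK' : ψ.fieldRange.fixingSubgroup ≤ ((thetaCurve P F).galoisRepTorsion (ℓ : ℤ)).ker)
    (u : HeightOneSpectrum (𝓞 K)) (hu : finBelow P.F K u ∈ badPlaces P) (hℓu : ((ℓ : ℕ) : 𝓞 K) ∉ u.asIdeal) :
    ℓ ∣ relRamIdx F K u :=
  ell_dvd_relRamIdx_of_le_ker ψ hU hF hℓP.1 h7 hℓP.2.2.2.1 hK' u hu hℓu

/-- **At «Initial Theta Data with the prime `ℓ`»** (`ITDConditions λ ℓ` = `7 ≤ ℓ ∧ (P2) ∧ (P5) ∧ (P6)`, E-t33's reading of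
Thm. 5.7.1's conclusion): the `h412` of p456387 discharged at every `K ⊇ L′`, `ℓ ∈ S` — no separate (P2) / `7 ≤ ℓ` binders.
PROVED. [claim: Joshi2024ATS4, status: disputed] -/
theorem h412_ofNFPointOver_of_itdConditions (hU : P.InU) (hF : IsThetaField P F) {ℓ : ℕ} (hℓ : ℓ.Prime)
    (hitd : ITDConditions P ℓ) (hK' : ψ.fieldRange.fixingSubgroup ≤ ((thetaCurve P F).galoisRepTorsion (ℓ : ℤ)).ker)
    {S : Finset ℕ} (hS : ℓ ∈ S) :
    ∀ w ∈ (TateDivisorDatum.ofNFPointOver P S F).V,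
      ∃ u : HeightOneSpectrum (𝓞 K), residueChar K u = residueChar F w ∧ 2 ≤ u.asIdeal.ramificationIdx ℤ :=
  h412_ofNFPointOver_of_le_ker ψ hU hF hℓ hitd.1 hitd.2.1 hK' hS

/-- **Lemma 6.7.1 (1) ⟺ (3) off `30ℓ` at `L′`, at «Initial Theta Data with the prime `ℓ`»** (`ITDConditions λ ℓ`), for Joshi's
`S = {2, ℓ}` — the rider and `ℓ ≥ 7` read off the standing data, as in print. PROVED. [claim: Joshi2024ATS4, status: disputed] -/
theorem primeFactors_discr_sdiff_eq_reading3_sdiff_of_itdConditions (hU : P.InU) (hF : IsThetaField P F) {ℓ : ℕ}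
    (hℓ : ℓ.Prime) (hitd : ITDConditions P ℓ) (hψ : ψ.fieldRange = (thetaCurve P F).divisionField ℓ) :
    (discr K).natAbs.primeFactors \ (2 * 3 * 5 * ℓ).primeFactors =
      ((TateDivisorDatum.ofNFPoint P {2, ℓ}).V.image (residueChar P.F) ∪ (discr P.F).natAbs.primeFactors) \
        (2 * 3 * 5 * ℓ).primeFactors :=
  primeFactors_discr_sdiff_eq_reading3_sdiff_of_fieldRange_eq_divisionField ψ hU hF hℓ hitd.1 hitd.2.1 hψ
    (pair_subset_quad ℓ) (prime_of_mem_pair hℓ) (by simp)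

end GenuineVdst

end Summit.ABC.IUTFork.Joshi.ATS4

end
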